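import Summits.CriticalPhenomena.CardyFormulaZ2.Theorems.CardyComplexConeParafermionToSLESixFamiliesDiamondDartPhasePath
import Summits.CriticalPhenomena.CardyFormulaZ2.Theorems.CardyComplexConeParafermionToSLESixFamiliesDiamondDartPhaseColour
import Summits.CriticalPhenomena.CardyFormulaZ2.Theorems.CardyComplexConeParafermionToSLESixFamiliesDiamondDartPhaseTestSeg
import Summits.CriticalPhenomena.CardyFormulaZ2.Theorems.CardyComplexConeParafermionToSLESixFamiliesDiamondArcsFrame
import Summits.CriticalPhenomena.CardyFormulaZ2.Theorems.CardyComplexConeParafermionToSLESixFamiliesDiamondTraceBulkArcs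
import Summits.CriticalPhenomena.CardyFormulaZ2.Theorems.CardyComplexConeParafermionToSLESixFamiliesDiamondIdentifyMesh
import HarnessLib

/-!
# The start edge of a diamond family sits at the counter-clockwise start of the free arc
# (line `potential-darboux-picard-diamond`, S1p `stub_boundaryDartPhase`, part 17)

Crux `ParafermionToSLESixFamilies` (stmt-CriticalPhenomena-11389), line `potential-darboux-picard-diamond`, stub
`stub_boundaryDartPhase` (S1p). The lattice–continuum link behind `BoundaryDartPhase`: along a family of admissible FK
Dobrushin data on a marked diamond, the start edge `e_a` (the `A`–`B` edge with the inner face on the left of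
`x₀ → b₀`, `x₀ ∈ A`, `b₀ ∈ B`) converges to the counter-clockwise START `ℓ s₁` of the free arc `D.arc 1 = ℓ [s₁, t₁]`
(`eventually_startCorner_near_freeStart`, registered; the hypothesis of `boundaryDartPhase_of_start`). By the Carathéodory
clause `e_a` is near one of the two marks; if it were near the END `b = ℓ t₁` of the free arc, the counter-clockwise
staircase from `b₀` (`exists_outPath`: out-edges, corners of the diamond included) would consist of `B`-sites
(`forall_mem_zdArcB_of_outPath`: the only other `A`–`B` edge is near the other mark, far away) and reach the bulk of a wired
test segment just after `b` on `D.arc 0` (`exists_wiredTestSegment`), where no `B`-site lies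
(`eventually_arcs_near_wiredSegment`).
-/

noncomputable section

namespace Summit.CriticalPhenomena.CardyFormulaZ2.Cruxes.ParafermionToSLESixFamilies.PotentialDarbouxPicardDiamond

open scoped Topology
open Filter Set Metric Complex
open Literature.Probability Literature.Probability.LatticeModels Literature.Probability.Percolation
open Literature.Probability.LatticeModels.DiscreteDobrushin
open Literature.Probability.RandomPlanarGeometry
open Summit.CriticalPhenomena.CardyFormulaZ2.Cruxes.ParafermionToSLESixFamilies.IicTraceFluxPairing (IsFamily)

/-! ## Small lattice facts -/

/-- A frame site of the box of S1c lies on the two layers of one of the four sides. -/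
theorem exists_layer_of_sdframe {a b a' b' : ℤ} {x : Site 2}
    (hfr : x 0 + x 1 ≤ a + 1 ∨ b - 1 ≤ x 0 + x 1 ∨ x 1 - x 0 ≤ a' + 1 ∨ b' - 1 ≤ x 1 - x 0) :
    ∃ j : Fin 4, (![-a', b, b', -a] : Fin 4 → ℤ) j - 1 ≤ xiC j x - upC j x := by
  rcases hfr with h | h | h | h
  · exact ⟨3, by simp [xiC, upC]; omega⟩
  · exact ⟨1, by simp [xiC, upC]; omega⟩
  · exact ⟨0, by simp [xiC, upC]; omega⟩
  · exact ⟨2, by simp [xiC, upC]; omega⟩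

/-- Sites of a lattice path stay within `i δ` of its start. -/
theorem dist_path_le {δ : ℝ} (hδ : 0 ≤ δ) {P : ℕ → Site 2} {L : ℕ}
    (hstep : ∀ i : ℕ, i < L → ∃ d : Fin 4, P (i + 1) = P i + cornerUnit d) :
    ∀ i : ℕ, i ≤ L → dist (meshPoint δ (P i)) (meshPoint δ (P 0)) ≤ i * δ := by
  intro i
  induction i with
  | zero => intro _; simp
  | succ i ih =>
    intro hi
    obtain ⟨d, hd⟩ := hstep i (Nat.lt_of_succ_le hi)
    have h1 : dist (meshPoint δ (P (i + 1))) (meshPoint δ (P i)) = δ := by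
      rw [hd, dist_eq_norm, norm_meshPoint_add_cornerUnit_sub hδ]
    have := dist_triangle (meshPoint δ (P (i + 1))) (meshPoint δ (P i)) (meshPoint δ (P 0))
    have := ih (Nat.le_of_succ_le hi)
    push_cast
    linarith

/-- An endpoint of a lattice edge is within `δ` of its medial point. -/
theorem dist_meshPoint_medialPoint_le {δ : ℝ} (hδ : 0 ≤ δ) (x : Site 2) (d : Fin 4) :
    dist (meshPoint δ x) (medialPoint δ s(x, x + cornerUnit d)) ≤ δ := by
  rw [medialPoint_mk, dist_eq_norm]
  have h := norm_meshPoint_add_cornerUnit_sub hδ x d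
  have e : meshPoint δ x - (meshPoint δ x + meshPoint δ (x + cornerUnit d)) / 2 = -((meshPoint δ (x + cornerUnit d) - meshPoint δ x) / 2) := by ring
  rw [e, norm_neg, norm_div, h, Complex.norm_two]
  linarith

section Calib

variable {D : DobrushinDomain} {c : ℂ} {α β δ : ℝ}
  (hcar : D.carrier = {z | |(dRot c z).re| < α ∧ |(dRot c z).im| < β}) {M : Fin 4 → ℤ}
  (hbox : ∀ x : Site 2, meshPoint δ x ∈ D.carrier ↔ ∀ j : Fin 4, xiC j x - upC j x ≤ M j) (hδ : 0 < δ) (k : Fin 4)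

include hcar hbox hδ in
/-- **A site near the line of side `k` is on a high layer**: `gam - F_k ≤ (N + 1) δ/√2` gives `X_k ≥ M k - 1 - N`. -/
theorem X_ge_of_Fk {x : Site 2} (hx : meshPoint δ x ∈ D.carrier) (N : ℕ)
    (hF : gam α β k - Fk k (dRot c (meshPoint δ x)) ≤ Real.sqrt 2 / 2 * δ * (N + 1)) : M k - 1 - N ≤ xiC k x - upC k x := by
  obtain ⟨h1, h2⟩ := sqrt_two_div_two_mul_bounds hδ
  have hxb := (hbox x).1 hx
  obtain ⟨hX0, hT0, hX1, hT1⟩ := (box_iff_side M k x).1 hxb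
  by_contra hlt
  push Not at hlt
  obtain ⟨m, hm1, hm2⟩ : ∃ m : ℤ, (N : ℤ) + 1 ≤ 2 * m ∧ 2 * m ≤ (N : ℤ) + 2 := ⟨((N : ℤ) + 2) / 2, by omega, by omega⟩
  have hm0 : (0 : ℝ) ≤ m := by exact_mod_cast (show (0 : ℤ) ≤ m by omega)
  have hm1' : (N : ℝ) + 1 ≤ 2 * m := by exact_mod_cast hm1
  have hy : meshPoint δ (x + m • cornerUnit k + m • cornerUnit (k + 3)) ∈ D.carrier := by
    rw [hbox, box_iff_side M k]
    simp only [xiC_add_smul3, xiC_add_smul0, upC_add_smul3, upC_add_smul0]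
    omega
  have hF' := ((mem_carrier_iff_frame hcar k _).1 hy).1
  rw [Fk_nshift, abs_lt] at hF'
  have : Real.sqrt 2 / 2 * δ * (N + 1) ≤ Real.sqrt 2 / 2 * δ * (2 * m) := mul_le_mul_of_nonneg_left hm1' (by positivity)
  linarith [hF'.2]

end Calib

/-! ## The position of the start edge -/

set_option maxHeartbeats 1600000 in
/-- **The start edge sits at the counter-clockwise start of the free arc** (registered helper of
`stub_boundaryDartPhase`; the hypothesis of `boundaryDartPhase_of_start`). See the module docstring. -/
theorem eventually_startCorner_near_freeStart : ∀ (D : DobrushinDomain) (c : ℂ) (α β : ℝ), 0 < α → 0 < β → D.carrier = {z | |((z - c) * exp (-(Real.pi / 4 : ℝ) * I)).re| < α ∧ |((z - c) * exp (-(Real.pi / 4 : ℝ) * I)).im| < β} → ∀ (Λ : ℝ → DiscreteDobrushin), IsFamily D Λ → ∀ (ℓ : ℝ → ℂ), Continuous ℓ → (∀ s : ℝ, ℓ (s + 2 * Real.pi) = ℓ s) → Set.range ℓ = frontier D.carrier → Set.InjOn ℓ (Set.Ico 0 (2 * Real.pi)) → (∀ (k : ℕ) (r : ℝ), 0 ≤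 r → r ≤ 1 → (k % 4 = 0 → dRot c (ℓ ((k + r) * (Real.pi / 2))) = dParam α β 1 (r * dLen α β 1)) ∧ (k % 4 = 1 → dRot c (ℓ ((k + r) * (Real.pi / 2))) = dParam α β 2 (r * dLen α β 2)) ∧ (k % 4 = 2 → dRot c (ℓ ((k + r) * (Real.pi / 2))) = dParam α β 3 (r * dLen α β 3)) ∧ (k % 4 = 3 → dRot c (ℓ ((k + r) * (Real.pi / 2))) = dParam α β 0 (r * dLen α β 0))) → ∀ (s₁ t₁ : ℝ), s₁ < t₁ → t₁ < s₁ + 2 * Real.pi → D.arc 1 = ℓ '' Set.Icc s₁ t₁ → D.arc 0 = ℓ '' Set.Icc t₁ (s₁ + 2 * Real.pi) → ∀ ε : ℝ, 0 < ε → ∀ᶠ δ in 𝓝[>] (0:ℝ), ∀ hδ : (Λ δ).IsZdAdmissible, dist (medialPoint δ (cSrc (startCorner hδ))) (ℓ s₁) ≤ ε := by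
  intro D c α β hα hβ hcar Λ hΛ ℓ hcont hper hrange hinj hframe s₁ t₁ hst hts harc1 harc0 ε hε
  have hcar' : D.carrier = {z | |(dRot c z).re| < α ∧ |(dRot c z).im| < β} := hcar
  have hΛ' := hΛ
  obtain ⟨hΩ, hmesh, -, -, hHaus, -⟩ := hΛ'
  have h2π := Real.two_pi_pos
  -- the two marks
  have hab : ℓ s₁ ≠ ℓ t₁ := fun h => by
    have := loop_injOn_window hper hinj s₁ ⟨le_rfl, by linarith⟩ ⟨hst.le, hts⟩ h; linarith
  have hdab : 0 < dist (ℓ s₁) (ℓ t₁) := dist_pos.2 hab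
  have hpt := pt_eq_or hper hinj hst hts harc1 harc0 (D := D)
  have haMmem : ℓ s₁ ∈ ({D.pt 0, D.pt 1} : Set ℂ) := by
    rcases hpt 0 with h0 | h0
    · exact Or.inl h0.symm
    · rcases hpt 1 with h1 | h1
      · exact Or.inr h1.symm
      · exact absurd (D.pt_injective (h0.trans h1.symm)) (by decide)
  -- the wired test segment after `b = ℓ t₁`
  obtain ⟨kb, σb, L₀, hσb0, hL₀, hroom, hbM, hsegs⟩ := exists_wiredTestSegment_core hα hβ hcar' hper hrange hinj hframe hst hts harc1 harc0
  -- the scale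
  set Lσ : ℝ := if 0 < σb then σb / 2 else L₀ with hLσ
  have hLσ0 : 0 < Lσ := by rw [hLσ]; split_ifs with h <;> linarith
  set L : ℝ := min (min L₀ (dist (ℓ s₁) (ℓ t₁) / 16)) (min Lσ (min α β / 4)) with hLdef
  have hL0 : 0 < L := lt_min (lt_min hL₀ (by linarith)) (lt_min hLσ0 (by positivity))
  have hLL₀ : L ≤ L₀ := (min_le_left _ _).trans (min_le_left _ _)
  have hLd : L ≤ dist (ℓ s₁) (ℓ t₁) / 16 := (min_le_left _ _).trans (min_le_right _ _)
  have hLσ' : 0 < σb → L ≤ σb / 2 := fun h => by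
    have : L ≤ Lσ := (min_le_right _ _).trans (min_le_left _ _)
    rw [hLσ, if_pos h] at this; exact this
  have hLm : L ≤ min α β / 4 := (min_le_right _ _).trans (min_le_right _ _)
  have hmg := min_le_gam α β kb
  obtain ⟨hW, hWsub⟩ := hsegs L (3 * L) hL0 (by linarith) (by linarith)
  have hw₁ : dRot c (dRotInv c (dParam α β kb (σb + L))) = dParam α β kb (σb + L) := dRot_dRotInv c _
  have hw₂ : dRot c (dRotInv c (dParam α β kb (σb + 3 * L))) = dParam α β kb (σb + 3 * L) := dRot_dRotInv c _
  -- eventual facts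
  have E1 := eventually_mem_meshDomain_of_isMarkedDiamond D ⟨c, α, β, hα, hβ, hcar⟩
  have E2 := eventually_arcs_near_wiredSegment hΛ hW hWsub (η := L / 2) (by positivity)
  have E3 := eventually_startCorner_near_marks D Λ hΛ (min ε (L / 8)) (lt_min hε (by positivity))
  have E4 := hHaus.eventually_lt_const (ENNReal.ofReal_pos.2 (show (0:ℝ) < L / 8 by positivity))
  have E5 : ∀ᶠ δ in 𝓝[>] (0:ℝ), 0 < δ ∧ δ < L / 100 := by
    filter_upwards [Ioo_mem_nhdsGT (show (0:ℝ) < L / 100 by positivity)] with δ hδ using hδ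
  filter_upwards [E1, E2, E3, E4, E5] with δ hgood harcs hnear hHd hδb
  obtain ⟨hδ0, hδL⟩ := hδb
  intro hadm
  -- near `a = ℓ s₁`: done; near `b = ℓ t₁`: impossible
  have hnear' : dist (medialPoint δ (cSrc (startCorner hadm))) (ℓ s₁) ≤ min ε (L / 8) ∨
      dist (medialPoint δ (cSrc (startCorner hadm))) (ℓ t₁) ≤ min ε (L / 8) := by
    rcases hnear hadm with h | h
    · rcases hpt 0 with e | e
      · rw [e] at h; exact Or.inl h
      · rw [e] at h; exact Or.inr h
    · rcases hpt 1 with e | e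
      · rw [e] at h; exact Or.inl h
      · rw [e] at h; exact Or.inr h
  rcases hnear' with h | hbnear
  · exact h.trans (min_le_left _ _)
  exfalso
  have hε₀ : dist (medialPoint δ (cSrc (startCorner hadm))) (ℓ t₁) ≤ L / 8 := hbnear.trans (min_le_right _ _)
  -- the datum
  have hEΩ : (Λ δ).Ω = D.carrier := hΩ δ
  have hEδ : (Λ δ).δ = δ := hmesh δ
  have hconv : Convex ℝ D.carrier := by rw [hcar]; exact convex_tiltedBox c _ α β
  have hsc := isStartCorner_startCorner hadm
  obtain ⟨b₀, hb₀⟩ : ∃ b₀ : Site 2, b₀ = (startCorner hadm).1 + cornerUnit (startCorner hadm).2 := ⟨_, rfl⟩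
  have hb₀B : b₀ ∈ (Λ δ).zdArcB := hb₀ ▸ hsc.mem_zdArcB
  have hb₀bd : b₀ ∈ (Λ δ).zdBoundary := (Λ δ).zdArcB_subset_zdBoundary hb₀B
  have hb₀in : meshPoint δ b₀ ∈ D.carrier := by
    have := mem_of_mem_zdBoundary hb₀bd; rwa [hEΩ, hEδ] at this
  -- the box
  have hLαβ : L ≤ α / 4 ∧ L ≤ β / 4 := ⟨hLm.trans (by linarith [min_le_left α β]), hLm.trans (by linarith [min_le_right α β])⟩
  obtain ⟨a, b, a', b', hba, -, hsd⟩ := diamondArcs_exists_box c α β δ hδ0 (by linarith [hLαβ.1]) (by linarith [hLαβ.2])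
  have hsd' : ∀ x : Site 2, meshPoint δ x ∈ D.carrier ↔ (a ≤ x 0 + x 1 ∧ x 0 + x 1 ≤ b ∧ a' ≤ x 1 - x 0 ∧ x 1 - x 0 ≤ b') :=
    fun x => by rw [← hsd x, hcar]; rfl
  set M : Fin 4 → ℤ := ![-a', b, b', -a] with hM
  have hboxM : ∀ x : Site 2, meshPoint δ x ∈ D.carrier ↔ ∀ j : Fin 4, xiC j x - upC j x ≤ M j := fun x => by
    rw [hsd', genBox_iff]
  have hfr : ∃ j : Fin 4, M j - 1 ≤ xiC j b₀ - upC j b₀ :=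
    exists_layer_of_sdframe (ArcsConn.mem_frame_of_mem_zdBoundary hconv hgood hEΩ hEδ hsd' hb₀bd).2
  -- `b₀` is near `b`
  set ρ : ℝ := L / 8 + 2 * δ with hρ
  have hb₀near : dist (meshPoint δ b₀) (ℓ t₁) ≤ ρ := by
    have h1 : dist (meshPoint δ b₀) (meshPoint δ (startCorner hadm).1) = δ := by
      rw [hb₀, dist_eq_norm, norm_meshPoint_add_cornerUnit_sub hδ0.le]
    have h2 := dist_medialPoint_cSrc_le hδ0.le (startCorner hadm)
    have := dist_triangle4 (meshPoint δ b₀) (meshPoint δ (startCorner hadm).1) (medialPoint δ (cSrc (startCorner hadm))) (ℓ t₁)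
    rw [dist_comm (meshPoint δ (startCorner hadm).1)] at this
    linarith
  have hdn : ‖dRot c (meshPoint δ b₀) - dParam α β kb σb‖ ≤ ρ := by rwa [← hbM, ← dist_eq_norm, dist_dRot]
  have hFb := abs_Fk_sub_le kb (dRot c (meshPoint δ b₀)) (dParam α β kb σb)
  have hGb := abs_Gk_sub_le kb (dRot c (meshPoint δ b₀)) (dParam α β kb σb)
  rw [Fk_dParam] at hFb
  rw [Gk_dParam] at hGb
  rw [abs_le] at hFb hGb
  obtain ⟨hh1, hh2⟩ := sqrt_two_div_two_mul_bounds hδ0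
  have hpos : 0 < Real.sqrt 2 / 2 * δ := by positivity
  have hLg : L ≤ gam α β kb / 4 := by linarith [min_le_gam α β kb]
  have hdL := dLen_eq α β kb
  -- the layers of `b₀` and the calibration of the box
  have hlay := layers_of_near hcar' hboxM hδ0 kb hb₀in hfr hbM hb₀near (by linarith) (by linarith)
  have hlayers : M kb - 1 ≤ xiC kb b₀ - upC kb b₀ ∨ M (kb + 3) - 1 ≤ xiC (kb + 3) b₀ - upC (kb + 3) b₀ :=
    hlay.imp_right fun h => h.1
  have hXlow : -M (kb + 2) + 3 ≤ xiC kb b₀ - upC kb b₀ := by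
    have := le_X_sub hcar' hboxM hδ0 kb hb₀in 0 (by push_cast; linarith)
    push_cast at this; linarith
  obtain ⟨hX0, hT0, hX1, hT1⟩ := (box_iff_side M kb b₀).1 ((hboxM b₀).1 hb₀in)
  have hw : 2 ≤ M kb + M (kb + 2) := by omega
  have hT2 := T_add_le hcar' hboxM hδ0 kb hb₀in 0 (by push_cast; linarith)
  have hw' : 2 ≤ M (kb + 3) + M (kb + 1) := by push_cast at hT2; omega
  -- the target tangential coordinate
  set targ : ℝ := σb + 2 * L - gam' α β kb - Gk kb (dRot c (meshPoint δ b₀)) with htarg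
  have htarg0 : 0 < targ := by linarith
  set nS : ℕ := ⌈targ / (Real.sqrt 2 / 2 * δ)⌉₊ with hnS
  have hnS1 : targ ≤ Real.sqrt 2 / 2 * δ * nS := by
    have := Nat.le_ceil (targ / (Real.sqrt 2 / 2 * δ)); rwa [div_le_iff₀' hpos] at this
  have hnS2 : Real.sqrt 2 / 2 * δ * nS < targ + Real.sqrt 2 / 2 * δ := by
    have := Nat.ceil_lt_add_one (div_nonneg htarg0.le hpos.le)
    have := mul_lt_mul_of_pos_left this hpos
    rwa [mul_add, mul_one, mul_div_cancel₀ _ hpos.ne'] at this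
  have hnSpos : 1 ≤ nS := Nat.one_le_iff_ne_zero.2 (Nat.pos_iff_ne_zero.1 (Nat.ceil_pos.2 (div_pos htarg0 hpos)))
  set Ts : ℤ := xiC kb b₀ + upC kb b₀ + nS with hTs
  have hTs1 : xiC kb b₀ + upC kb b₀ + 1 ≤ Ts := by omega
  have hTs2 : Ts + 2 ≤ M (kb + 1) := by
    have := T_add_le hcar' hboxM hδ0 kb hb₀in nS (by nlinarith)
    omega
  -- the path
  obtain ⟨P, Lp, hP0, hstep, hPinj, hXL, hTL, hLlen⟩ :=
    exists_outPath D.carrier hconv δ hgood (Λ δ) hEΩ hEδ M hboxM hadm kb (hb₀ ▸ hlayers) (hb₀ ▸ hXlow) hw hw' Ts (hb₀ ▸ hTs1) hTs2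
  rw [← hb₀] at hP0 hLlen
  -- the other `A`–`B` edge is near `a`
  rw [hausdorffEDist_comm] at hHd
  obtain ⟨mp, hmp, hdist⟩ := exists_edist_lt_of_hausdorffEDist_lt haMmem hHd
  obtain ⟨eb, hebAB, rfl⟩ := hmp
  rw [edist_lt_ofReal] at hdist
  have heb_ne : eb ≠ cSrc (startCorner hadm) := by
    rintro rfl
    have := dist_triangle (ℓ s₁) (medialPoint δ (cSrc (startCorner hadm))) (ℓ t₁)
    linarith
  have hAB : ∀ e ∈ (Λ δ).zdABEdges, e = cSrc (startCorner hadm) ∨ e = eb := fun e he => by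
    by_cases h : e = cSrc (startCorner hadm)
    · exact Or.inl h
    · exact Or.inr (eq_of_mem_zdABEdges_of_ne hadm he hebAB h heb_ne)
  -- the path is short
  set N : ℕ := ⌈ρ / (Real.sqrt 2 / 2 * δ)⌉₊ with hN
  have hN1 : ρ ≤ Real.sqrt 2 / 2 * δ * N := by
    have := Nat.le_ceil (ρ / (Real.sqrt 2 / 2 * δ)); rwa [div_le_iff₀' hpos] at this
  have hN2 : Real.sqrt 2 / 2 * δ * N < ρ + Real.sqrt 2 / 2 * δ := by
    have := Nat.ceil_lt_add_one (div_nonneg (by positivity : (0:ℝ) ≤ ρ) hpos.le)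
    have := mul_lt_mul_of_pos_left this hpos
    rwa [mul_add, mul_one, mul_div_cancel₀ _ hpos.ne'] at this
  have hXN := X_ge_of_Fk hcar' hboxM hδ0 kb hb₀in N (by nlinarith)
  have hLp : (Lp : ℝ) * δ ≤ 5 * L := by
    have h1 : (Lp : ℤ) ≤ nS + N + 1 := by
      have := max_le (show (0:ℤ) ≤ N from by positivity) (show M kb - 1 - (xiC kb b₀ - upC kb b₀) ≤ N by omega)
      omega
    have h2 : (Lp : ℝ) ≤ nS + N + 1 := by exact_mod_cast h1
    have h3 : Real.sqrt 2 / 2 * δ * Lp ≤ Real.sqrt 2 / 2 * δ * (nS + N + 1) := mul_le_mul_of_nonneg_left h2 hpos.le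
    nlinarith
  have hPnear : ∀ i : ℕ, i ≤ Lp → dist (meshPoint δ (P i)) (ℓ t₁) ≤ 5 * L + ρ := fun i hi => by
    have h1 := dist_path_le hδ0.le (fun i hi => (hstep i hi).imp fun d hd => hd.1) i hi
    rw [hP0] at h1
    have h2 : (i : ℝ) * δ ≤ Lp * δ := by gcongr
    have := dist_triangle (meshPoint δ (P i)) (meshPoint δ b₀) (ℓ t₁)
    linarith
  have heb : ∀ i : ℕ, i < Lp → s(P i, P (i + 1)) ≠ eb := by
    intro i hi h
    obtain ⟨d, hd, -⟩ := hstep i hi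
    have h1 : dist (meshPoint δ (P i)) (medialPoint δ eb) ≤ δ := by rw [← h, hd]; exact dist_meshPoint_medialPoint_le hδ0.le _ _
    have h2 := hPnear i hi.le
    have := dist_triangle4 (ℓ s₁) (medialPoint δ eb) (meshPoint δ (P i)) (ℓ t₁)
    rw [dist_comm (medialPoint δ eb)] at this
    linarith
  have hPB := forall_mem_zdArcB_of_outPath (Λ δ) hadm eb hAB P Lp (by rw [hP0, hb₀]) hstep hPinj heb
  -- the end of the path is a `B`-site in the bulk of the wired test segment
  have hyB := hPB Lp le_rfl
  have hyin : meshPoint δ (P Lp) ∈ D.carrier := by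
    have := mem_of_mem_zdBoundary ((Λ δ).zdArcB_subset_zdBoundary hyB); rwa [hEΩ, hEδ] at this
  have hGy : Gk kb (dRot c (meshPoint δ (P Lp))) = Gk kb (dRot c (meshPoint δ b₀)) + Real.sqrt 2 / 2 * δ * nS := by
    have := Gk_meshPoint_sub c δ kb (P Lp) b₀
    rw [hTL, hTs, show (xiC kb b₀ + upC kb b₀ + (nS : ℤ) - (xiC kb b₀ + upC kb b₀) : ℤ) = nS by ring] at this
    push_cast at this
    linarith
  have hFy1 := gam_le_Fk_add hcar' hboxM hδ0 kb hyin hXL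
  have hFy2 := (abs_lt.1 ((mem_carrier_iff_frame hcar' kb _).1 hyin).1).2
  have hinf : infDist (meshPoint δ (P Lp)) (segment ℝ (dRotInv c (dParam α β kb (σb + L))) (dRotInv c (dParam α β kb (σb + 3 * L)))) ≤ 6 * δ := by
    refine (infDist_piece_le kb (by linarith) (by linarith)).trans ?_
    rw [abs_le]; constructor <;> linarith
  have hd1 : L / 2 ≤ dist (meshPoint δ (P Lp)) (dRotInv c (dParam α β kb (σb + L))) := by
    have := abs_Gk_sub_le kb (dRot c (meshPoint δ (P Lp))) (dRot c (dRotInv c (dParam α β kb (σb + L))))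
    rw [← dist_eq_norm, dist_dRot, hw₁, Gk_dParam] at this
    have := le_abs_self (Gk kb (dRot c (meshPoint δ (P Lp))) - (σb + L - gam' α β kb))
    linarith
  have hd2 : L / 2 ≤ dist (meshPoint δ (P Lp)) (dRotInv c (dParam α β kb (σb + 3 * L))) := by
    have := abs_Gk_sub_le kb (dRot c (meshPoint δ (P Lp))) (dRot c (dRotInv c (dParam α β kb (σb + 3 * L))))
    rw [← dist_eq_norm, dist_dRot, hw₂, Gk_dParam] at this
    have := neg_le_abs (Gk kb (dRot c (meshPoint δ (P Lp))) - (σb + 3 * L - gam' α β kb))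
    linarith
  exact (harcs (P Lp) hinf hd1 hd2).1 hyB

end Summit.CriticalPhenomena.CardyFormulaZ2.Cruxes.ParafermionToSLESixFamilies.PotentialDarbouxPicardDiamond

end
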